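import Summits.HodgeConjecture.HodgeConjecture.Theorems.VHCAbelianSchemesRoadSecantQuotientAnchorPinnedDefs
import Summits.HodgeConjecture.HodgeConjecture.Theorems.VHCAbelianSchemesRoadTwistedDoorIsoRespects
import HarnessLib

/-!
# Road b02 (`VHCAbelianSchemesRoad`, D-0059) — lane W1 of crux `SemiregularSheafRepresentativesTwAtDiag` (item stmt-HodgeConjecture-19787),
# stub 2a″: the served-WITH-DATUM directions at an anchor are closed under the polarisation-preserving AUTOMORPHISMS (orbit closure, fact-free)

research route conditional on HC_CM; not a corollary; Q11.4-sentence-2 already refuted in dim ≥ 3.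

THEOREMS ONLY (no definition, no named fact; `HC_CM` nowhere). Gap (G3) of the card (one door datum serves ONE direction) moves for free along
automorphisms: for an object class `𝒪` that RESPECTS ISOMORPHISMS (the crux's twisted door does, hypothesis-free — ring2-b06 g119 p529156
`twistedDoor_respectsIso`), a datum serving `w₀` at `(X, θ)` transports along every automorphism `g : X ≅ X` with `g^*θ = θ` to a datum serving `g^*w₀`
at `(X, θ)`. Hence `AnchoredCarrierAt 𝒪 n p 𝔄 𝔖₀ ⟹ AnchoredCarrierAt 𝒪 n p 𝔄 𝔖` whenever every class of `𝔖 X θ` is `g^*` of a rational class of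
`𝔖₀ X θ` for such a `g` (§1, door-generic), and the twisted-door instance for 2a″'s data (§2). HONEST size of the gain (evidence n°42 §2 (v)):
at a pinned secant–quotient anchor the automorphisms preserving `θ` and the Weil structure act on the Weil plane `W_ℚ ≅ K` through roots of unity
of `K`, so an `Aut`-orbit of directions is FINITE — (G3) stays a `P¹(ℚ)`-worth of door-inequivalent objects up to finitely many identifications.
Nothing here says 2a″, any cell or HC holds. References: [cite: Bloch1972Semiregularity, Remark (7.5)] [cite: Markman2025SecantWeil, Thm. 1.4.1 (item 4) and §1.5]
[cite: Andre1996Motifs, §1.1 (p. 10)].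
-/

noncomputable section

open CategoryTheory CategoryTheory.Limits AlgebraicGeometry Topology

namespace Summit.HodgeConjecture.HodgeConjecture.Ring2.SemiregularRepresentatives

set_option linter.dupNamespace false -- the cell's namespace repeats the summit name, as in every `Ring2*` file

open Literature.AlgebraicGeometry Literature.AlgebraicGeometry.Motives
open Literature.AlgebraicGeometry.HodgeTheory
open Literature.AlgebraicTopology.SingularHomology
open Summit.Ventures.HSemireg (ObjClass)

/-! ## §1 Orbit closure, door-generic -/

section Orbit

variable {𝒪 : ObjClass} {n p : ℕ} {𝔄 : ∀ X : SchemeOver ℂ, complexBetti X 2 → Prop}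
  {𝔖₀ 𝔖 : ∀ (X : SchemeOver ℂ), complexBetti X 2 → Set (complexBetti X (2 * p))}

/-- **ORBIT CLOSURE OF THE SERVED-WITH-DATUM DIRECTIONS**: if `𝒪` respects isomorphisms and every class `w ∈ 𝔖 X θ` at an anchor is
`g^*w₀` for a `θ`-preserving automorphism `g : X ≅ X` and a rational `w₀ ∈ 𝔖₀ X θ`, then carriers for `𝔖₀` give carriers for `𝔖`
(transport the datum `κ ↦ g^*κ`; `g^*θ^q = θ^q`). [cite: Bloch1972Semiregularity, Remark (7.5)] [cite: Andre1996Motifs, §1.1 (p. 10)] -/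
theorem anchoredCarrierAt_of_autOrbit
    (h𝒪 : ∀ (m : ℕ) ⦃Y Y' : SchemeOver ℂ⦄ (e : Y' ≅ Y) (I : Finset ℕ) (κ : (q : ℕ) → complexBetti Y (2 * q)),
      𝒪 m Y I κ → 𝒪 m Y' I (fun q ↦ complexBetti.map e.hom (2 * q) (κ q)))
    (horb : ∀ (X : SchemeOver ℂ) (θ : complexBetti X 2), 𝔄 X θ → ∀ w ∈ 𝔖 X θ,
      ∃ (g : X ≅ X) (w₀ : complexBetti X (2 * p)), complexBetti.map g.hom 2 θ = θ ∧ w₀ ∈ 𝔖₀ X θ ∧ IsRationalClass w₀ ∧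
        w = complexBetti.map g.hom (2 * p) w₀)
    (h : AnchoredCarrierAt 𝒪 n p 𝔄 𝔖₀) : AnchoredCarrierAt 𝒪 n p 𝔄 𝔖 := by
  intro X θ hXθ w hw _
  obtain ⟨g, w₀, hgθ, hw₀, hw₀Q, rfl⟩ := horb X θ hXθ w hw
  obtain ⟨I, κ, a, c, hpI, hκ, ha, hκp, hκq⟩ := h X θ hXθ w₀ hw₀ hw₀Q
  refine ⟨I, fun q ↦ complexBetti.map g.hom (2 * q) (κ q), a, c, hpI, h𝒪 n g I κ hκ, ha, ?_, fun q hq hqp ↦ ?_⟩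
  · change complexBetti.map g.hom (2 * p) (κ p) = _
    rw [hκp, map_add, map_smul, map_smul, map_cupPowTwo, hgθ]
  · change complexBetti.map g.hom (2 * q) (κ q) = _
    rw [hκq q hq hqp, map_smul, map_cupPowTwo, hgθ]

end Orbit

/-! ## §2 The twisted door: 2a″'s served directions are `Aut(X, θ)`-orbit closed for free -/

/-- **For the crux's twisted door** (iso-respecting by `twistedDoor_respectsIso`, p529156): carriers for a sub-family `𝔖₀ ⊆ 𝔖^pin` of pinned-served
directions whose `Aut(X, θ)`-orbits exhaust `𝔖^pin` give the full 2a″ datum `AnchoredCarrierAt (tw C AdmTw) 6 3 𝔄^pin 𝔖^pin`. The orbit hypothesis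
is DISPLAYED; at a generic anchor it fails beyond finitely many identifications (module docstring).
[cite: Markman2025SecantWeil, Thm. 1.4.1 (item 4) and §1.5] [cite: Bloch1972Semiregularity, Remark (7.5)] -/
theorem anchoredCarrierAt_tw_secantQuotientPinned_of_autOrbit {C : ChernCharacterBetti}
    {𝔖₀ : ∀ (X : SchemeOver ℂ), complexBetti X 2 → Set (complexBetti X (2 * 3))}
    (horb : ∀ (X : SchemeOver ℂ) (θ : complexBetti X 2), secantQuotientAnchorsPinned X θ → ∀ w ∈ secantQuotientServedClassesPinned X θ,
      ∃ (g : X ≅ X) (w₀ : complexBetti X (2 * 3)), complexBetti.map g.hom 2 θ = θ ∧ w₀ ∈ 𝔖₀ X θ ∧ IsRationalClass w₀ ∧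
        w = complexBetti.map g.hom (2 * 3) w₀)
    (h : AnchoredCarrierAt (Literature.AlgebraicGeometry.HodgeTheory.twistedReflexiveClass C
        (fun n X₀ I E => Summit.Ventures.HSemireg.gluableSigmaAdmissible n X₀ I E ∨
          Literature.AlgebraicGeometry.HodgeTheory.bfSingleAdmissible n X₀ I E)) 6 3
      (fun X θ ↦ secantQuotientAnchorsPinned X θ) 𝔖₀) :
    AnchoredCarrierAt (Literature.AlgebraicGeometry.HodgeTheory.twistedReflexiveClass C
        (fun n X₀ I E => Summit.Ventures.HSemireg.gluableSigmaAdmissible n X₀ I E ∨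
          Literature.AlgebraicGeometry.HodgeTheory.bfSingleAdmissible n X₀ I E)) 6 3
      (fun X θ ↦ secantQuotientAnchorsPinned X θ) (fun X θ ↦ secantQuotientServedClassesPinned X θ) :=
  anchoredCarrierAt_of_autOrbit (twistedDoor_respectsIso C) horb h

end Summit.HodgeConjecture.HodgeConjecture.Ring2.SemiregularRepresentatives

end
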